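import Literature.NumberTheory.Sieve.SmoothEndgameArcs
import Literature.NumberTheory.Sieve.SmoothEndgameCircle
import Literature.NumberTheory.Sieve.SmoothEndgamePoints
import HarnessLib

/-!
# The endgame for smooth `a + b = c`: the central arc

Topic `Literature/NumberTheory/Sieve`; a PROVED file toward
`Literature.NumberTheory.DiophantineGeometry.XYZUpperHalf` ([Harper2016, Cor. 1], §5 with the
smooth weight `w(v) = v²(1−v)²`). On the discrete circle `r/N₀` (`N₀ = ⌊x⌋`) the central points are
those with `r x/N₀ ≤ Q` (near `0`) or `(N₀ − r) x/N₀ ≤ Q` (near `1`). There the weighted sums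
`S₃ = S_w(·; x)`, `S₁ = S_w(·; x/2)` are compared with the models `M₃ = M_{𝓜, x, α}`,
`M₁ = M_{2^{−α}𝓜, x/2, α}` of `SmoothEndgameCircle`: both are
`𝓜 Ŵ_λ(α) + O((ε + e^{−66}) 𝓜/(1+|λ|))` resp. `2^{−α}𝓜 Ŵ_{λ/2}(α) + …` (`arc_estimate` at `q = 1`,
`norm_modelSum_sub_main_le`), so that

`‖S₁² S̄₃ − M₁² M̄₃‖ ≤ 200 (ε + e^{−66}) 𝓜₁² 𝓜/(1+|λ|)³` (`central_point_bound`, `central_pointwise`)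

and, summing with `∑_r (1+|λ_r|)^{−2} ≤ 4` on each side (`SmoothEndgamePoints`),

`∑_{r central} ‖S₁² S̄₃ − M₁² M̄₃‖ ≤ 1600 (ε + e^{−66}) 𝓜₁² 𝓜` (`central_sum_le`).

## References

* A. J. Harper, Compositio Math. 152 (2016), §5 [Harper2016].
-/

noncomputable section

open Finset Real Complex
open scoped FourierTransform ComplexConjugate

namespace Literature.NumberTheory.Sieve

namespace Endgame

open MontgomeryVaughan1975 TwistedWeight SmoothArcs Vinogradov

/-! ### Abstract cubic comparison -/

/-- `‖S₁² S̄₃ − M₁² M̄₃‖ ≤ (44 ε₁ + 25 ε₃) m₁² m₃` when `‖S_i − M_i‖ ≤ ε_i m_i`, `‖M₁‖ ≤ 5m₁`,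
`‖M₃‖ ≤ 3m₃`, `ε_i ≤ 1`. [folklore] -/
theorem norm_cubic_sub_le {S₁ S₃ M₁ M₃ : ℂ} {m₁ m₃ ε₁ ε₃ : ℝ} (hm₁ : 0 ≤ m₁) (hm₃ : 0 ≤ m₃)
    (hε₁ : 0 ≤ ε₁) (hε₁1 : ε₁ ≤ 1) (hε₃1 : ε₃ ≤ 1)
    (h1 : ‖S₁ - M₁‖ ≤ ε₁ * m₁) (h3 : ‖S₃ - M₃‖ ≤ ε₃ * m₃) (hM₁ : ‖M₁‖ ≤ 5 * m₁) (hM₃ : ‖M₃‖ ≤ 3 * m₃) :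
    ‖S₁ ^ 2 * conj S₃ - M₁ ^ 2 * conj M₃‖ ≤ (44 * ε₁ + 25 * ε₃) * (m₁ ^ 2 * m₃) := by
  have hS₁ : ‖S₁‖ ≤ 6 * m₁ := by
    calc ‖S₁‖ = ‖M₁ + (S₁ - M₁)‖ := by ring_nf
      _ ≤ ‖M₁‖ + ‖S₁ - M₁‖ := norm_add_le _ _
      _ ≤ 5 * m₁ + ε₁ * m₁ := add_le_add hM₁ h1
      _ ≤ 6 * m₁ := by nlinarith
  have hS₃ : ‖S₃‖ ≤ 4 * m₃ := by
    calc ‖S₃‖ = ‖M₃ + (S₃ - M₃)‖ := by ring_nf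
      _ ≤ ‖M₃‖ + ‖S₃ - M₃‖ := norm_add_le _ _
      _ ≤ 3 * m₃ + ε₃ * m₃ := add_le_add hM₃ h3
      _ ≤ 4 * m₃ := by nlinarith
  have hid : S₁ ^ 2 * conj S₃ - M₁ ^ 2 * conj M₃ =
      (S₁ - M₁) * (S₁ + M₁) * conj S₃ + M₁ ^ 2 * conj (S₃ - M₃) := by
    rw [map_sub]; ring
  rw [hid]
  have hsum : ‖S₁ + M₁‖ ≤ 11 * m₁ := (norm_add_le _ _).trans (by linarith)
  calc ‖(S₁ - M₁) * (S₁ + M₁) * conj S₃ + M₁ ^ 2 * conj (S₃ - M₃)‖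
      ≤ ‖S₁ - M₁‖ * ‖S₁ + M₁‖ * ‖S₃‖ + ‖M₁‖ ^ 2 * ‖S₃ - M₃‖ := by
        refine (norm_add_le _ _).trans (le_of_eq ?_)
        rw [norm_mul, norm_mul, norm_mul, norm_pow, Complex.norm_conj, Complex.norm_conj]
    _ ≤ (ε₁ * m₁) * (11 * m₁) * (4 * m₃) + (5 * m₁) ^ 2 * (ε₃ * m₃) := by
        gcongr
    _ = (44 * ε₁ + 25 * ε₃) * (m₁ ^ 2 * m₃) := by ring

/-- **The central points, abstractly.** If `S₃`, `M₃` are within `εp 𝓜/(1+|λ|) + N` resp. `J` of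
`𝓜 W` with `‖W‖ ≤ 2/(1+|λ|)`, likewise `S₁`, `M₁` of `𝓜₁ W'` with `‖W'‖ ≤ 2/(1+|λ/2|)`, and the
junk is small, `(1+Λ)(N+J) ≤ εp 𝓜₁` (`|λ| ≤ Λ`, `𝓜₁ ≤ 𝓜`, `εp ≤ 1/4`), then
`‖S₁² S̄₃ − M₁² M̄₃‖ ≤ 200 εp 𝓜₁²𝓜/(1+|λ|)³`. [cite: Harper2016, §5] -/
theorem central_point_bound {S₁ S₃ M₁ M₃ W W' : ℂ} {𝓜 𝓜₁ lam Λ εp N J : ℝ}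
    (h𝓜₁ : 0 ≤ 𝓜₁) (h𝓜₁le : 𝓜₁ ≤ 𝓜) (hlam : |lam| ≤ Λ) (hεp : 0 ≤ εp) (hεp1 : εp ≤ 1 / 4)
    (hN : 0 ≤ N) (hJ0 : 0 ≤ J)
    (hW : ‖W‖ ≤ 2 / (1 + |lam|)) (hW' : ‖W'‖ ≤ 2 / (1 + |lam / 2|))
    (hS₃ : ‖S₃ - 𝓜 * W‖ ≤ εp * 𝓜 / (1 + |lam|) + N) (hS₁ : ‖S₁ - 𝓜₁ * W'‖ ≤ εp * 𝓜₁ / (1 + |lam / 2|) + N)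
    (hM₃ : ‖M₃ - 𝓜 * W‖ ≤ J) (hM₁ : ‖M₁ - 𝓜₁ * W'‖ ≤ J)
    (hsmall : (1 + Λ) * (N + J) ≤ εp * 𝓜₁) :
    ‖S₁ ^ 2 * conj S₃ - M₁ ^ 2 * conj M₃‖ ≤ 200 * εp * (𝓜₁ ^ 2 * 𝓜 / (1 + |lam|) ^ 3) := by
  have h𝓜 : 0 ≤ 𝓜 := h𝓜₁.trans h𝓜₁le
  have hl0 : 0 ≤ |lam| := abs_nonneg _
  have hden : 0 < 1 + |lam| := by linarith
  set m₃ : ℝ := 𝓜 / (1 + |lam|) with hm₃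
  set m₁ : ℝ := 𝓜₁ / (1 + |lam|) with hm₁
  have hm₁0 : 0 ≤ m₁ := div_nonneg h𝓜₁ hden.le
  have hm₃0 : 0 ≤ m₃ := div_nonneg h𝓜 hden.le
  have hm₁₃ : m₁ ≤ m₃ := div_le_div_of_nonneg_right h𝓜₁le hden.le
  -- `N + J ≤ εp 𝓜₁/(1+Λ) ≤ εp m₁`
  have hΛ : |lam| ≤ Λ := hlam
  have hNJ : N + J ≤ εp * m₁ := by
    have h1 : (1 + |lam|) * (N + J) ≤ (1 + Λ) * (N + J) := mul_le_mul_of_nonneg_right (by linarith) (by linarith)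
    rw [hm₁, mul_div_assoc']
    rw [le_div_iff₀ hden]
    linarith
  -- `1/(1+|λ/2|) ≤ 2/(1+|λ|)`
  have hhalf : 1 / (1 + |lam / 2|) ≤ 2 / (1 + |lam|) := by
    rw [abs_div, abs_two, div_le_div_iff₀ (by positivity) hden]; linarith
  -- the four inputs of `norm_cubic_sub_le`
  have h3 : ‖S₃ - M₃‖ ≤ (2 * εp) * m₃ := by
    calc ‖S₃ - M₃‖ = ‖(S₃ - 𝓜 * W) - (M₃ - 𝓜 * W)‖ := by ring_nf
      _ ≤ ‖S₃ - 𝓜 * W‖ + ‖M₃ - 𝓜 * W‖ := norm_sub_le _ _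
      _ ≤ εp * 𝓜 / (1 + |lam|) + N + J := by linarith
      _ ≤ εp * m₃ + εp * m₁ := by rw [hm₃, mul_div_assoc]; linarith
      _ ≤ (2 * εp) * m₃ := by nlinarith
  have h1 : ‖S₁ - M₁‖ ≤ (3 * εp) * m₁ := by
    have hS₁' : εp * 𝓜₁ / (1 + |lam / 2|) ≤ 2 * (εp * m₁) := by
      rw [hm₁]
      calc εp * 𝓜₁ / (1 + |lam / 2|) = (εp * 𝓜₁) * (1 / (1 + |lam / 2|)) := by ring
        _ ≤ (εp * 𝓜₁) * (2 / (1 + |lam|)) := mul_le_mul_of_nonneg_left hhalf (by positivity)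
        _ = 2 * (εp * (𝓜₁ / (1 + |lam|))) := by ring
    calc ‖S₁ - M₁‖ = ‖(S₁ - 𝓜₁ * W') - (M₁ - 𝓜₁ * W')‖ := by ring_nf
      _ ≤ ‖S₁ - 𝓜₁ * W'‖ + ‖M₁ - 𝓜₁ * W'‖ := norm_sub_le _ _
      _ ≤ εp * 𝓜₁ / (1 + |lam / 2|) + N + J := by linarith
      _ ≤ (3 * εp) * m₁ := by linarith
  have hM₃' : ‖M₃‖ ≤ 3 * m₃ := by
    have hW𝓜 : ‖(𝓜 : ℂ) * W‖ ≤ 2 * m₃ := by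
      rw [norm_mul, Complex.norm_real, Real.norm_eq_abs, abs_of_nonneg h𝓜, hm₃]
      calc 𝓜 * ‖W‖ ≤ 𝓜 * (2 / (1 + |lam|)) := mul_le_mul_of_nonneg_left hW h𝓜
        _ = 2 * (𝓜 / (1 + |lam|)) := by ring
    calc ‖M₃‖ = ‖𝓜 * W + (M₃ - 𝓜 * W)‖ := by ring_nf
      _ ≤ ‖(𝓜 : ℂ) * W‖ + ‖M₃ - 𝓜 * W‖ := norm_add_le _ _
      _ ≤ 2 * m₃ + J := add_le_add hW𝓜 hM₃
      _ ≤ 3 * m₃ := by nlinarith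
  have hM₁' : ‖M₁‖ ≤ 5 * m₁ := by
    have hW𝓜 : ‖(𝓜₁ : ℂ) * W'‖ ≤ 4 * m₁ := by
      rw [norm_mul, Complex.norm_real, Real.norm_eq_abs, abs_of_nonneg h𝓜₁, hm₁]
      calc 𝓜₁ * ‖W'‖ ≤ 𝓜₁ * (2 / (1 + |lam / 2|)) := mul_le_mul_of_nonneg_left hW' h𝓜₁
        _ = (2 * 𝓜₁) * (1 / (1 + |lam / 2|)) := by ring
        _ ≤ (2 * 𝓜₁) * (2 / (1 + |lam|)) := mul_le_mul_of_nonneg_left hhalf (by positivity)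
        _ = 4 * (𝓜₁ / (1 + |lam|)) := by ring
    calc ‖M₁‖ = ‖𝓜₁ * W' + (M₁ - 𝓜₁ * W')‖ := by ring_nf
      _ ≤ ‖(𝓜₁ : ℂ) * W'‖ + ‖M₁ - 𝓜₁ * W'‖ := norm_add_le _ _
      _ ≤ 4 * m₁ + J := add_le_add hW𝓜 hM₁
      _ ≤ 5 * m₁ := by nlinarith
  have h := norm_cubic_sub_le hm₁0 hm₃0 (by positivity) (by linarith) (by linarith) h1 h3 hM₁' hM₃'
  refine h.trans ?_
  have hm : m₁ ^ 2 * m₃ = 𝓜₁ ^ 2 * 𝓜 / (1 + |lam|) ^ 3 := by rw [hm₁, hm₃]; field_simp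
  rw [hm]
  have : 0 ≤ 𝓜₁ ^ 2 * 𝓜 / (1 + |lam|) ^ 3 := by positivity
  nlinarith

/-! ### Periodicity of the model sum and the Mellin bound at `t = 0` -/

/-- `M(θ + a) = M(θ)` for natural `a`. [folklore] -/
theorem modelSum_add_nat (M X α θ : ℝ) (a : ℕ) : modelSum M X α ((a : ℝ) + θ) = modelSum M X α θ := by
  unfold modelSum
  refine Finset.sum_congr rfl fun n _ => ?_
  congr 1
  have : (n : ℝ) * ((a : ℝ) + θ) = (n : ℝ) * θ + ((n * a : ℕ) : ℤ) := by push_cast; ring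
  rw [this, AddChar.map_add_eq_mul, Circle.coe_mul, RamanujanSum.fourierChar_intCast, mul_one]

/-- `‖Ŵ_λ(α)‖ ≤ 2/(1+|λ|)` for `0 < α ≤ 1`. [folklore] -/
theorem norm_twistMellin_real_le {α : ℝ} (hα : 0 < α) (hα1 : α ≤ 1) (lam : ℝ) :
    ‖twistMellin lam α‖ ≤ 2 / (1 + |lam|) := by
  have h := norm_twistMellin_le_two_div hα hα1 (show |(0 : ℝ)| ≤ 3 by norm_num) lam
  simpa using h

/-! ### The central points of the circle -/

/-- `e^{−66} ≤ 1/5`. [folklore] -/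
theorem exp_neg_66_le : Real.exp (-66) ≤ 1 / 5 := by
  have h5 : (5 : ℝ) ≤ Real.exp 2 := by
    have := Real.quadratic_le_exp_of_nonneg (show (0 : ℝ) ≤ 2 by norm_num); linarith
  calc Real.exp (-66) ≤ Real.exp (-2) := Real.exp_le_exp.mpr (by norm_num)
    _ = (Real.exp 2)⁻¹ := by rw [Real.exp_neg]
    _ ≤ 5⁻¹ := by rw [inv_le_inv₀ (Real.exp_pos 2) (by norm_num)]; exact h5
    _ = 1 / 5 := by norm_num

set_option maxHeartbeats 1600000 in
/-- **Pointwise at a central point.** See `central_sum_le` for the hypotheses; for `|λ| ≤ Λ` and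
`a ∈ {0, 1}`:
`‖S₁(a+λ/x)² S̄₃(a+λ/x) − M₁(a+λ/x)² M̄₃(a+λ/x)‖ ≤ 200 (ε+e^{−66}) 𝓜₁²𝓜/(1+|λ|)³`.
[cite: Harper2016, §5] -/
theorem central_pointwise {ε : ℝ} (hε : 0 < ε) (hε1 : ε ≤ 1 / 20) {δ₀ θ : ℝ} (hδ₀ : 0 ≤ δ₀) (hδ₀' : δ₀ ≤ 1 / 20)
    (hθ0 : 0 < θ) (hθ : θ ≤ 1 / 5) :
    ∃ x₀ : ℝ, ∀ (x : ℝ) (y : ℕ), x₀ ≤ x → Real.log x ^ 4 ≤ y → (y : ℝ) ≤ x →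
      Real.log y ≤ Real.log x ^ (1 / 6 : ℝ) → GoodLevel δ₀ θ y → 25 ≤ Real.log y →
      40 * ((y : ℝ) ^ (1 - θ) + 1) ≤ (y : ℝ) ^ (1 - θ / 2) → (y : ℝ) ^ θ + 1 ≤ (y : ℝ) ^ (1 - θ / 2) →
      3 * (y : ℝ) ^ (1 - θ / 2) ≤ y →
      ∀ Λ : ℝ, 2 ≤ Λ → Λ ^ 8 ≤ (y : ℝ) → Λ ≤ (y : ℝ) ^ θ → Λ ≤ Real.log x ^ 100 →
      (1 + Λ) * ((x ^ saddlePoint x y * smoothZeta (saddlePoint x y) y / (2 * π)) *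
          decayNu y θ (saddlePoint x y) Λ +
        2 * (x ^ saddlePoint x y * smoothZeta (saddlePoint x y) y /
          Real.sqrt (2 * Real.pi * saddlePhi₂ (saddlePoint x y) y)) * (5 + 2 * π * Λ) / x) ≤
        (ε + Real.exp (-66)) * ((2 : ℝ) ^ (-saddlePoint x y) * (x ^ saddlePoint x y * smoothZeta (saddlePoint x y) y /
          Real.sqrt (2 * Real.pi * saddlePhi₂ (saddlePoint x y) y))) →
      ∀ a : ℕ, a ≤ 1 → ∀ lam : ℝ, |lam| ≤ Λ →
      ‖smoothWeightSum (x / 2) y ((a : ℝ) + lam / x) ^ 2 * conj (smoothWeightSum x y ((a : ℝ) + lam / x)) -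
          modelSum ((2 : ℝ) ^ (-saddlePoint x y) * (x ^ saddlePoint x y * smoothZeta (saddlePoint x y) y /
              Real.sqrt (2 * Real.pi * saddlePhi₂ (saddlePoint x y) y))) (x / 2) (saddlePoint x y)
              ((a : ℝ) + lam / x) ^ 2 *
            conj (modelSum (x ^ saddlePoint x y * smoothZeta (saddlePoint x y) y /
              Real.sqrt (2 * Real.pi * saddlePhi₂ (saddlePoint x y) y)) x (saddlePoint x y) ((a : ℝ) + lam / x))‖ ≤
        200 * (ε + Real.exp (-66)) *
          (((2 : ℝ) ^ (-saddlePoint x y) * (x ^ saddlePoint x y * smoothZeta (saddlePoint x y) y /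
              Real.sqrt (2 * Real.pi * saddlePhi₂ (saddlePoint x y) y))) ^ 2 *
            (x ^ saddlePoint x y * smoothZeta (saddlePoint x y) y /
              Real.sqrt (2 * Real.pi * saddlePhi₂ (saddlePoint x y) y)) / (1 + |lam|) ^ 3) := by
  obtain ⟨x₀A, hA⟩ := arc_estimate hε hδ₀ hδ₀' hθ0 hθ
  obtain ⟨x₃₅, h35⟩ := three_fifths_le_saddlePoint
  obtain ⟨x₁, hlt1⟩ := saddlePoint_lt_one
  refine ⟨max (max x₀A x₃₅) (max x₁ (Real.exp 1)), fun x y hx hy4 hyx hylog hgood hy25 hy40 hyq hy3 Λ hΛ2 hΛ8 hΛθ hΛL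
    hsmall a ha lam hlam => ?_⟩
  have hx₀A : x₀A ≤ x := le_trans ((le_max_left _ _).trans (le_max_left _ _)) hx
  have hx₃₅ : x₃₅ ≤ x := le_trans ((le_max_right _ _).trans (le_max_left _ _)) hx
  have hx₁ : x₁ ≤ x := le_trans ((le_max_left _ _).trans (le_max_right _ _)) hx
  have hxe : Real.exp 1 ≤ x := le_trans ((le_max_right _ _).trans (le_max_right _ _)) hx
  have hx0 : 0 < x := lt_of_lt_of_le (Real.exp_pos 1) hxe
  have hx2 : 2 ≤ x := le_trans (by have := Real.add_one_le_exp (1 : ℝ); linarith) hxe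
  have hlogx1 : 1 ≤ Real.log x := by
    have := Real.log_le_log (Real.exp_pos 1) hxe; rwa [Real.log_exp] at this
  have hy3' : Real.log x ^ 3 ≤ y := le_trans (pow_le_pow_right₀ hlogx1 (by norm_num)) hy4
  set α : ℝ := saddlePoint x y with hα
  have hα35 : 3 / 5 ≤ α := h35 x y hx₃₅ hy3' hyx
  have hα1 : α ≤ 1 := (hlt1 x y hx₁ hy3' hyx hylog).le
  have hα0 : 0 < α := by linarith
  set Mx : ℝ := x ^ α * smoothZeta α y / Real.sqrt (2 * Real.pi * saddlePhi₂ α y) with hMx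
  set M₁ : ℝ := (2 : ℝ) ^ (-α) * Mx with hM₁
  have hζ : 0 < smoothZeta α y := smoothZeta_pos hα0
  have hMx0 : 0 ≤ Mx := by rw [hMx]; positivity
  have h2α : (2 : ℝ) ^ (-α) ≤ 1 := Real.rpow_le_one_of_one_le_of_nonpos (by norm_num) (by linarith)
  have h2α0 : 0 < (2 : ℝ) ^ (-α) := Real.rpow_pos_of_pos (by norm_num) _
  have hM₁0 : 0 ≤ M₁ := by positivity
  have hM₁le : M₁ ≤ Mx := by rw [hM₁]; nlinarith
  have hΛ1 : 1 ≤ Λ := by linarith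
  have hlamΛ : |lam / 2| ≤ Λ := by rw [abs_div, abs_two]; linarith [abs_nonneg lam]
  -- `a` is `0` or `1`: coprime to `1`
  have hcop : a.Coprime 1 := Nat.coprime_one_right a
  -- ### `S₃` and `S₁` via `arc_estimate` at `q = 1`
  have h1L : ((1 * 1 : ℕ) : ℝ) ≤ Real.log x ^ 100 := by
    norm_num; exact le_trans (by norm_num) (le_trans hΛ2 hΛL)
  have h2L : ((2 * 1 : ℕ) : ℝ) ≤ Real.log x ^ 100 := by norm_num; exact le_trans hΛ2 hΛL
  have h1Λ : ((1 : ℕ) : ℝ) ≤ Λ := by norm_num; exact hΛ1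
  have hA₃ := hA x y hx₀A hy4 hyx hylog hgood hy25 hy40 hyq hy3 Λ hΛ1 hΛ8 hΛθ 1 le_rfl 1 h1Λ h1L a hcop lam hlam
  have hA₁ := hA x y hx₀A hy4 hyx hylog hgood hy25 hy40 hyq hy3 Λ hΛ1 hΛ8 hΛθ 2 (by norm_num) 1 h1Λ h2L a hcop (lam / 2) hlamΛ
  rw [← hα] at hA₃ hA₁
  simp only [Nat.cast_one, div_one, Real.one_rpow, one_mul, localG_one, localH_one, Complex.ofReal_one, mul_one,
    one_pow, Real.sqrt_one, Nat.cast_ofNat] at hA₃ hA₁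
  -- the angles
  have hθ₃ : smoothWeightSum x y ((a : ℝ) + lam / x) = arcSum x y 1 a lam := by
    have := smoothWeightSum_eq_arcSum hx0 y 1 a lam
    simpa using this
  have hθ₁ : smoothWeightSum (x / 2) y ((a : ℝ) + lam / x) = arcSum (x / 2) y 1 a (lam / 2) := by
    have := smoothWeightSum_eq_arcSum (half_pos hx0) y 1 a (lam / 2)
    have e : lam / 2 / (x / 2) = lam / x := by field_simp
    rw [e] at this
    simpa using this
  -- ### the models
  have hx1 : 1 ≤ x := by linarith
  have hx21 : 1 ≤ x / 2 := by linarith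
  have hM₃m := norm_modelSum_sub_main_le hMx0 hx1 hα0.le hα1 lam
  have hM₁m := norm_modelSum_sub_main_le hM₁0 hx21 hα0.le hα1 (lam / 2)
  have e12 : lam / 2 / (x / 2) = lam / x := by field_simp
  rw [e12] at hM₁m
  rw [← modelSum_add_nat Mx x α (lam / x) a] at hM₃m
  rw [← modelSum_add_nat M₁ (x / 2) α (lam / x) a] at hM₁m
  -- ### the junk bound `J`
  set J : ℝ := 2 * Mx * (5 + 2 * π * Λ) / x with hJ
  have hπ := Real.pi_pos
  have hΛlam : 5 + 2 * π * |lam| ≤ 5 + 2 * π * Λ := by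
    have := mul_le_mul_of_nonneg_left hlam (show (0 : ℝ) ≤ 2 * π by positivity); linarith
  have hΛlam' : 5 + 2 * π * |lam / 2| ≤ 5 + 2 * π * Λ := by
    have := mul_le_mul_of_nonneg_left hlamΛ (show (0 : ℝ) ≤ 2 * π by positivity); linarith
  have hpos5 : 0 ≤ Mx * (5 + 2 * π * Λ) := by positivity
  have hJ₃ : Mx / x * (5 + 2 * π * |lam|) ≤ J := by
    rw [hJ, div_mul_eq_mul_div]
    apply div_le_div_of_nonneg_right _ hx0.le
    calc Mx * (5 + 2 * π * |lam|) ≤ Mx * (5 + 2 * π * Λ) := mul_le_mul_of_nonneg_left hΛlam hMx0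
      _ ≤ 2 * Mx * (5 + 2 * π * Λ) := by linarith
  have hJ₁ : M₁ / (x / 2) * (5 + 2 * π * |lam / 2|) ≤ J := by
    rw [hJ]
    have e : M₁ / (x / 2) * (5 + 2 * π * |lam / 2|) = 2 * M₁ * (5 + 2 * π * |lam / 2|) / x := by field_simp
    rw [e]
    apply div_le_div_of_nonneg_right _ hx0.le
    calc 2 * M₁ * (5 + 2 * π * |lam / 2|) ≤ 2 * M₁ * (5 + 2 * π * Λ) := mul_le_mul_of_nonneg_left hΛlam' (by positivity)
      _ ≤ 2 * Mx * (5 + 2 * π * Λ) := by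
          have := mul_le_mul_of_nonneg_right hM₁le (show 0 ≤ 5 + 2 * π * Λ by positivity); linarith
  -- ### assemble via `central_point_bound`
  set N : ℝ := (x ^ α * smoothZeta α y / (2 * π)) * decayNu y θ α Λ with hN
  have hN0 : 0 ≤ N := by have := decayNu_nonneg y θ α Λ; positivity
  have hJ0 : 0 ≤ J := by positivity
  rw [hθ₃, hθ₁]
  rw [← hMx] at hA₃ hA₁
  rw [← hM₁] at hA₁
  have hεp1 : ε + Real.exp (-66) ≤ 1 / 4 := by have := exp_neg_66_le; linarith
  have hS₃' : ‖arcSum x y 1 a lam - (Mx : ℂ) * twistMellin lam α‖ ≤ (ε + Real.exp (-66)) * Mx / (1 + |lam|) + N := by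
    refine hA₃.trans (le_of_eq ?_); rw [hN]
  have hS₁' : ‖arcSum (x / 2) y 1 a (lam / 2) - (M₁ : ℂ) * twistMellin (lam / 2) α‖ ≤
      (ε + Real.exp (-66)) * M₁ / (1 + |lam / 2|) + N := by
    refine hA₁.trans (le_of_eq ?_); rw [hN]
  have hsmall' : (1 + Λ) * (N + J) ≤ (ε + Real.exp (-66)) * M₁ := by rw [hN, hJ]; exact hsmall
  exact central_point_bound (W := twistMellin lam α) (W' := twistMellin (lam / 2) α)
    hM₁0 hM₁le hlam (by positivity) hεp1 hN0 hJ0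
    (norm_twistMellin_real_le hα0 hα1 lam) (norm_twistMellin_real_le hα0 hα1 (lam / 2)) hS₃' hS₁'
    (hM₃m.trans hJ₃) (hM₁m.trans hJ₁) hsmall'


/-- Sums over a union of two filters, for a non-negative summand. [folklore] -/
theorem sum_filter_or_le {s : Finset ℕ} (P R : ℕ → Prop) [DecidablePred P] [DecidablePred R] (f : ℕ → ℝ)
    (hf : ∀ r ∈ s, 0 ≤ f r) :
    ∑ r ∈ s.filter (fun r => P r ∨ R r), f r ≤ ∑ r ∈ s.filter P, f r + ∑ r ∈ s.filter R, f r := by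
  classical
  rw [Finset.filter_or, ← Finset.sum_union_inter]
  have : 0 ≤ ∑ r ∈ s.filter P ∩ s.filter R, f r :=
    Finset.sum_nonneg fun r hr => hf r (Finset.mem_of_mem_filter r (Finset.mem_inter.mp hr).1)
  linarith

set_option maxHeartbeats 1600000 in
/-- **The central arc.** In the regime of `central_pointwise` (with `Λ ≥ 2`, `N₀ = ⌊x⌋`):
`∑_{r central} ‖S₁(r/N₀)² S̄₃(r/N₀) − M₁(r/N₀)² M̄₃(r/N₀)‖ ≤ 1600 (ε + e^{−66}) 𝓜₁² 𝓜`, the central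
points being those with `r x/N₀ ≤ Λ/2` or `(N₀ − r) x/N₀ ≤ Λ/2`. [cite: Harper2016, §5] -/
theorem central_sum_le {ε : ℝ} (hε : 0 < ε) (hε1 : ε ≤ 1 / 20) {δ₀ θ : ℝ} (hδ₀ : 0 ≤ δ₀) (hδ₀' : δ₀ ≤ 1 / 20)
    (hθ0 : 0 < θ) (hθ : θ ≤ 1 / 5) :
    ∃ x₀ : ℝ, ∀ (x : ℝ) (y : ℕ), x₀ ≤ x → Real.log x ^ 4 ≤ y → (y : ℝ) ≤ x →
      Real.log y ≤ Real.log x ^ (1 / 6 : ℝ) → GoodLevel δ₀ θ y → 25 ≤ Real.log y →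
      40 * ((y : ℝ) ^ (1 - θ) + 1) ≤ (y : ℝ) ^ (1 - θ / 2) → (y : ℝ) ^ θ + 1 ≤ (y : ℝ) ^ (1 - θ / 2) →
      3 * (y : ℝ) ^ (1 - θ / 2) ≤ y →
      ∀ Λ : ℝ, 2 ≤ Λ → Λ ^ 8 ≤ (y : ℝ) → Λ ≤ (y : ℝ) ^ θ → Λ ≤ Real.log x ^ 100 →
      (1 + Λ) * ((x ^ saddlePoint x y * smoothZeta (saddlePoint x y) y / (2 * π)) *
          decayNu y θ (saddlePoint x y) Λ +
        2 * (x ^ saddlePoint x y * smoothZeta (saddlePoint x y) y /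
          Real.sqrt (2 * Real.pi * saddlePhi₂ (saddlePoint x y) y)) * (5 + 2 * π * Λ) / x) ≤
        (ε + Real.exp (-66)) * ((2 : ℝ) ^ (-saddlePoint x y) * (x ^ saddlePoint x y * smoothZeta (saddlePoint x y) y /
          Real.sqrt (2 * Real.pi * saddlePhi₂ (saddlePoint x y) y))) →
      (∑ r ∈ (Finset.range ⌊x⌋₊).filter
          (fun r : ℕ => (r : ℝ) * x / ⌊x⌋₊ ≤ Λ / 2 ∨ ((⌊x⌋₊ : ℝ) - r) * x / ⌊x⌋₊ ≤ Λ / 2),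
        ‖smoothWeightSum (x / 2) y ((r : ℝ) / ⌊x⌋₊) ^ 2 * conj (smoothWeightSum x y ((r : ℝ) / ⌊x⌋₊)) -
          modelSum ((2 : ℝ) ^ (-saddlePoint x y) * (x ^ saddlePoint x y * smoothZeta (saddlePoint x y) y /
              Real.sqrt (2 * Real.pi * saddlePhi₂ (saddlePoint x y) y))) (x / 2) (saddlePoint x y)
              ((r : ℝ) / ⌊x⌋₊) ^ 2 *
            conj (modelSum (x ^ saddlePoint x y * smoothZeta (saddlePoint x y) y /
              Real.sqrt (2 * Real.pi * saddlePhi₂ (saddlePoint x y) y)) x (saddlePoint x y) ((r : ℝ) / ⌊x⌋₊))‖) ≤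
        1600 * (ε + Real.exp (-66)) *
          (((2 : ℝ) ^ (-saddlePoint x y) * (x ^ saddlePoint x y * smoothZeta (saddlePoint x y) y /
              Real.sqrt (2 * Real.pi * saddlePhi₂ (saddlePoint x y) y))) ^ 2 *
            (x ^ saddlePoint x y * smoothZeta (saddlePoint x y) y /
              Real.sqrt (2 * Real.pi * saddlePhi₂ (saddlePoint x y) y))) := by
  classical
  obtain ⟨x₀, hP⟩ := central_pointwise hε hε1 hδ₀ hδ₀' hθ0 hθ
  refine ⟨max x₀ 2, fun x y hx hy4 hyx hylog hgood hy25 hy40 hyq hy3 Λ hΛ2 hΛ8 hΛθ hΛL hsmall => ?_⟩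
  have hx₀ : x₀ ≤ x := le_trans (le_max_left _ _) hx
  have hx2 : 2 ≤ x := le_trans (le_max_right _ _) hx
  have hx0 : 0 < x := by linarith
  set N₀ : ℕ := ⌊x⌋₊ with hN₀
  have hN₀1 : 1 ≤ N₀ := Nat.le_floor (by simpa using (show (1 : ℝ) ≤ x by linarith))
  have hN₀pos : 0 < N₀ := hN₀1
  have hN₀x : (N₀ : ℝ) ≤ x := Nat.floor_le hx0.le
  have hN₀0 : (0 : ℝ) < N₀ := by exact_mod_cast hN₀pos
  set α : ℝ := saddlePoint x y with hα
  set Mx : ℝ := x ^ α * smoothZeta α y / Real.sqrt (2 * Real.pi * saddlePhi₂ α y) with hMx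
  set M₁ : ℝ := (2 : ℝ) ^ (-α) * Mx with hM₁
  set T : ℝ := M₁ ^ 2 * Mx with hT
  have hy2 : 2 ≤ y := by
    have hy1 : (1 : ℝ) < y := by
      by_contra h0; push Not at h0
      have := Real.log_nonpos (Nat.cast_nonneg y) h0; linarith
    have : 1 < y := by exact_mod_cast hy1
    omega
  have hα0 : 0 < α := saddlePoint_pos (by linarith) hy2
  have hζ : 0 < smoothZeta α y := smoothZeta_pos hα0
  have hMx0 : 0 ≤ Mx := by rw [hMx]; positivity
  have hT0 : 0 ≤ T := by rw [hT, hM₁]; positivity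
  have hε' : 0 ≤ ε + Real.exp (-66) := by positivity
  set F : ℕ → ℝ := fun r =>
    ‖smoothWeightSum (x / 2) y ((r : ℝ) / N₀) ^ 2 * conj (smoothWeightSum x y ((r : ℝ) / N₀)) -
      modelSum M₁ (x / 2) α ((r : ℝ) / N₀) ^ 2 * conj (modelSum Mx x α ((r : ℝ) / N₀))‖ with hF
  have hF0 : ∀ r, 0 ≤ F r := fun r => norm_nonneg _
  have hpt : ∀ (a : ℕ), a ≤ 1 → ∀ lam : ℝ, |lam| ≤ Λ →
      ‖smoothWeightSum (x / 2) y ((a : ℝ) + lam / x) ^ 2 * conj (smoothWeightSum x y ((a : ℝ) + lam / x)) -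
        modelSum M₁ (x / 2) α ((a : ℝ) + lam / x) ^ 2 * conj (modelSum Mx x α ((a : ℝ) + lam / x))‖ ≤
        200 * (ε + Real.exp (-66)) * (T / (1 + |lam|) ^ 3) :=
    fun a ha lam hlam => hP x y hx₀ hy4 hyx hylog hgood hy25 hy40 hyq hy3 Λ hΛ2 hΛ8 hΛθ hΛL hsmall a ha lam hlam
  -- pointwise along the two sides
  have hcube : ∀ lam : ℝ, T / (1 + |lam|) ^ 3 ≤ T * (1 / (1 + |lam|) ^ 2) := by
    intro lam
    have h0 : 0 ≤ |lam| := abs_nonneg lam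
    rw [div_eq_mul_one_div]
    apply mul_le_mul_of_nonneg_left _ hT0
    apply one_div_le_one_div_of_le (by positivity)
    nlinarith [pow_le_pow_right₀ (show (1 : ℝ) ≤ 1 + |lam| by linarith) (show 2 ≤ 3 by norm_num)]
  have hleft : ∀ r ∈ (Finset.range N₀).filter (fun r : ℕ => (r : ℝ) * x / N₀ ≤ Λ / 2),
      F r ≤ 200 * (ε + Real.exp (-66)) * T * (1 / (1 + |((r : ℝ) / N₀ - 0) * x|) ^ 2) := by
    intro r hr
    obtain ⟨-, hrQ⟩ := Finset.mem_filter.mp hr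
    set lam : ℝ := (r : ℝ) * x / N₀ with hlam
    have hlam0 : 0 ≤ lam := by positivity
    have hlamΛ : |lam| ≤ Λ := by rw [abs_of_nonneg hlam0]; linarith
    have hθr : (r : ℝ) / N₀ = ((0 : ℕ) : ℝ) + lam / x := by rw [hlam]; field_simp; ring
    have e : ((r : ℝ) / N₀ - 0) * x = lam := by rw [hlam, sub_zero]; field_simp
    rw [e]
    have h := hpt 0 (by norm_num) lam hlamΛ
    rw [← hθr] at h
    refine h.trans ?_
    have := hcube lam
    calc 200 * (ε + Real.exp (-66)) * (T / (1 + |lam|) ^ 3) ≤ 200 * (ε + Real.exp (-66)) * (T * (1 / (1 + |lam|) ^ 2)) :=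
          mul_le_mul_of_nonneg_left this (by positivity)
      _ = _ := by ring
  have hright : ∀ r ∈ (Finset.range N₀).filter (fun r : ℕ => ((N₀ : ℝ) - r) * x / N₀ ≤ Λ / 2),
      F r ≤ 200 * (ε + Real.exp (-66)) * T * (1 / (1 + |((r : ℝ) / N₀ - 1) * x|) ^ 2) := by
    intro r hr
    obtain ⟨hrN, hrQ⟩ := Finset.mem_filter.mp hr
    have hrN' : (r : ℝ) < N₀ := by exact_mod_cast Finset.mem_range.mp hrN
    set lam : ℝ := ((r : ℝ) - N₀) * x / N₀ with hlam
    have hlam0 : lam ≤ 0 := by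
      rw [hlam]; apply div_nonpos_of_nonpos_of_nonneg _ hN₀0.le; nlinarith
    have hlamΛ : |lam| ≤ Λ := by
      rw [abs_of_nonpos hlam0, hlam]
      have : -(((r : ℝ) - N₀) * x / N₀) = ((N₀ : ℝ) - r) * x / N₀ := by ring
      rw [this]; linarith
    have hθr : (r : ℝ) / N₀ = ((1 : ℕ) : ℝ) + lam / x := by rw [hlam]; field_simp; ring
    have e : ((r : ℝ) / N₀ - 1) * x = lam := by rw [hlam]; field_simp
    rw [e]
    have h := hpt 1 le_rfl lam hlamΛ
    rw [← hθr] at h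
    refine h.trans ?_
    have := hcube lam
    calc 200 * (ε + Real.exp (-66)) * (T / (1 + |lam|) ^ 3) ≤ 200 * (ε + Real.exp (-66)) * (T * (1 / (1 + |lam|) ^ 2)) :=
          mul_le_mul_of_nonneg_left this (by positivity)
      _ = _ := by ring
  have hsumL := sum_range_inv_one_add_abs_arc_sq_le hN₀pos hN₀x (c' := 0) le_rfl
  have hsumR := sum_range_inv_one_add_abs_arc_sq_le hN₀pos hN₀x (c' := 1) zero_le_one
  have hL : ∑ r ∈ (Finset.range N₀).filter (fun r : ℕ => (r : ℝ) * x / N₀ ≤ Λ / 2), F r ≤ 200 * (ε + Real.exp (-66)) * T * 4 := by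
    calc _ ≤ ∑ r ∈ (Finset.range N₀).filter (fun r : ℕ => (r : ℝ) * x / N₀ ≤ Λ / 2),
          200 * (ε + Real.exp (-66)) * T * (1 / (1 + |((r : ℝ) / N₀ - 0) * x|) ^ 2) := Finset.sum_le_sum hleft
      _ ≤ ∑ r ∈ Finset.range N₀, 200 * (ε + Real.exp (-66)) * T * (1 / (1 + |((r : ℝ) / N₀ - 0) * x|) ^ 2) :=
          Finset.sum_le_sum_of_subset_of_nonneg (Finset.filter_subset _ _) fun r _ _ => by positivity
      _ = 200 * (ε + Real.exp (-66)) * T * ∑ r ∈ Finset.range N₀, 1 / (1 + |((r : ℝ) / N₀ - 0) * x|) ^ 2 := by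
          rw [Finset.mul_sum]
      _ ≤ 200 * (ε + Real.exp (-66)) * T * 4 := mul_le_mul_of_nonneg_left hsumL (by positivity)
  have hR : ∑ r ∈ (Finset.range N₀).filter (fun r : ℕ => ((N₀ : ℝ) - r) * x / N₀ ≤ Λ / 2), F r ≤ 200 * (ε + Real.exp (-66)) * T * 4 := by
    calc _ ≤ ∑ r ∈ (Finset.range N₀).filter (fun r : ℕ => ((N₀ : ℝ) - r) * x / N₀ ≤ Λ / 2),
          200 * (ε + Real.exp (-66)) * T * (1 / (1 + |((r : ℝ) / N₀ - 1) * x|) ^ 2) := Finset.sum_le_sum hright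
      _ ≤ ∑ r ∈ Finset.range N₀, 200 * (ε + Real.exp (-66)) * T * (1 / (1 + |((r : ℝ) / N₀ - 1) * x|) ^ 2) :=
          Finset.sum_le_sum_of_subset_of_nonneg (Finset.filter_subset _ _) fun r _ _ => by positivity
      _ = 200 * (ε + Real.exp (-66)) * T * ∑ r ∈ Finset.range N₀, 1 / (1 + |((r : ℝ) / N₀ - 1) * x|) ^ 2 := by
          rw [Finset.mul_sum]
      _ ≤ 200 * (ε + Real.exp (-66)) * T * 4 := mul_le_mul_of_nonneg_left hsumR (by positivity)
  have hor := sum_filter_or_le (s := Finset.range N₀) (fun r : ℕ => (r : ℝ) * x / N₀ ≤ Λ / 2)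
    (fun r : ℕ => ((N₀ : ℝ) - r) * x / N₀ ≤ Λ / 2) F (fun r _ => hF0 r)
  calc _ = ∑ r ∈ (Finset.range N₀).filter (fun r : ℕ => (r : ℝ) * x / N₀ ≤ Λ / 2 ∨ ((N₀ : ℝ) - r) * x / N₀ ≤ Λ / 2), F r := rfl
    _ ≤ _ := hor
    _ ≤ 200 * (ε + Real.exp (-66)) * T * 4 + 200 * (ε + Real.exp (-66)) * T * 4 := add_le_add hL hR
    _ = 1600 * (ε + Real.exp (-66)) * (M₁ ^ 2 * Mx) := by rw [hT]; ring

end Endgame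

end Literature.NumberTheory.Sieve

end
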